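import Literature.Analysis.FluidPDE.CompressibleEulerSymmetricForm
import HarnessLib

/-!
# The symmetriser coefficients of the nonisentropic Euler system along a solution

Analysis/FluidPDE support file (everything proved; no named facts), part of the programme
proving `Literature.Analysis.FluidPDE.CompressibleEulerLocalWellPosedness` (Majda 1984,
Thms 2.1–2.2). For the athermal monatomic law `p = ρϑζ(ρ)`, `e = (3/2)ϑ` the primitive system in
symmetric form (`IsPrimitiveEulerSolutionOn.euler_monatomicExcess`, `.temperature_eq`) has the
coefficient fields, along a solution `(ρ, u, ϑ)`,

  `a = ϑ h'(ρ)/ρ` (`coefA`), `b = ζ(ρ)` (`coefB`), `g = (2/3) ϑ ζ(ρ)` (`coefG`),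
  `d₃ = (3/2) ρ/ϑ` (`coefD`, the energy weight with `d₃ g = ρ b`),

`h(s) = sζ(s)`. This file names them, records their joint smoothness on slabs `[0, τ]`, the weight
identity `d₃ g = ρ b`, and the three equations as identities of functions of `x`
(`res₁/₂/₃_fun_eq_zero`), the starting point of the differentiated system
(`CompressibleEulerDifferentiatedSystem`) and of the `H³` energy estimate (Majda 1984, Ch. 2
§2.1, (2.3)–(2.4) and proof of Thm 2.1).

## References

* A. Majda, *Compressible Fluid Flow and Systems of Conservation Laws in Several Space
  Variables*, Springer 1984, Ch. 2 §2.1. [`Majda1984`]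
-/

noncomputable section

open Set Function
open scoped ContDiff

namespace Literature.Analysis.FluidPDE

namespace CompressibleEuler

open Literature.Analysis.FunctionSpaces FunctionSpaces.Torus

variable {ζ f : ℝ → ℝ} {τ : ℝ} {ρ ϑ : ℝ → UnitAddTorus (Fin 3) → ℝ}
  {u : ℝ → UnitAddTorus (Fin 3) → EuclideanSpace ℝ (Fin 3)}

/-- The acoustic coefficient `a = ϑ · (h'(ρ)/ρ)`, `h(s) = sζ(s)`, along the solution. [folklore] -/
def coefA (ζ : ℝ → ℝ) (ρ ϑ : ℝ → UnitAddTorus (Fin 3) → ℝ) : ℝ → UnitAddTorus (Fin 3) → ℝ :=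
  fun s y => ϑ s y * (deriv (fun r : ℝ => r * ζ r) (ρ s y) / ρ s y)

/-- The coefficient `b = ζ(ρ)` along the solution. [folklore] -/
def coefB (ζ : ℝ → ℝ) (ρ : ℝ → UnitAddTorus (Fin 3) → ℝ) : ℝ → UnitAddTorus (Fin 3) → ℝ :=
  fun s y => ζ (ρ s y)

/-- The coefficient `g = (2/3) ϑ ζ(ρ)` along the solution. [folklore] -/
def coefG (ζ : ℝ → ℝ) (ρ ϑ : ℝ → UnitAddTorus (Fin 3) → ℝ) : ℝ → UnitAddTorus (Fin 3) → ℝ :=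
  fun s y => 2 / 3 * (ϑ s y * ζ (ρ s y))

/-- The temperature energy weight `d₃ = (3/2) ρ/ϑ` along the solution. [folklore] -/
def coefD (ρ ϑ : ℝ → UnitAddTorus (Fin 3) → ℝ) : ℝ → UnitAddTorus (Fin 3) → ℝ :=
  fun s y => 3 / 2 * (ρ s y * (ϑ s y)⁻¹)

/-- The weight identity `d₃ g = ρ b` (whenever `ϑ ≠ 0`). [folklore] -/
theorem coefD_mul_coefG {s : ℝ} {y : UnitAddTorus (Fin 3)} (hϑ : ϑ s y ≠ 0) :
    coefD ρ ϑ s y * coefG ζ ρ ϑ s y = ρ s y * coefB ζ ρ s y := by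
  simp only [coefD, coefG, coefB]
  field_simp

section Smooth

variable (hζ : ContDiff ℝ ∞ ζ) (h : IsPrimitiveEulerSolutionOn (EulerEOS.monatomicExcess ζ f) (Icc 0 τ) ρ u ϑ)

include hζ h in
/-- `a` is jointly smooth on the slab. [folklore] -/
theorem isSmoothSpaceTimeOn_coefA : IsSmoothSpaceTimeOn (Icc 0 τ) (coefA ζ ρ ϑ) := by
  have hdh : ContDiff ℝ ∞ (deriv fun r : ℝ => r * ζ r) := contDiff_deriv_mul_zeta hζ
  have sdh : IsSmoothSpaceTimeOn (Icc 0 τ) (fun s y => deriv (fun r : ℝ => r * ζ r) (ρ s y)) :=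
    hdh.comp_contDiffOn h.smooth_density
  have hρne : ∀ z ∈ Icc 0 τ ×ˢ (univ : Set (EuclideanSpace ℝ (Fin 3))), stLift ρ z ≠ 0 := fun z hz =>
    (h.density_pos z.1 hz.1 _).ne'
  exact h.smooth_temperature.mul (sdh.div h.smooth_density hρne)

include hζ h in
/-- `b` is jointly smooth on the slab. [folklore] -/
theorem isSmoothSpaceTimeOn_coefB : IsSmoothSpaceTimeOn (Icc 0 τ) (coefB ζ ρ) :=
  hζ.comp_contDiffOn h.smooth_density

include hζ h in
/-- `g` is jointly smooth on the slab. [folklore] -/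
theorem isSmoothSpaceTimeOn_coefG : IsSmoothSpaceTimeOn (Icc 0 τ) (coefG ζ ρ ϑ) := by
  have sζ : IsSmoothSpaceTimeOn (Icc 0 τ) (fun s y => ζ (ρ s y)) := hζ.comp_contDiffOn h.smooth_density
  exact (h.smooth_temperature.mul sζ).const_smul (2 / 3 : ℝ)

include h in
/-- `d₃` is jointly smooth on the slab. [folklore] -/
theorem isSmoothSpaceTimeOn_coefD : IsSmoothSpaceTimeOn (Icc 0 τ) (coefD ρ ϑ) := by
  have hϑne : ∀ z ∈ Icc 0 τ ×ˢ (univ : Set (EuclideanSpace ℝ (Fin 3))), stLift ϑ z ≠ 0 := fun z hz =>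
    (h.temperature_pos z.1 hz.1 _).ne'
  have hinv : IsSmoothSpaceTimeOn (Icc 0 τ) (fun s y => (ϑ s y)⁻¹) := h.smooth_temperature.inv hϑne
  exact (h.smooth_density.mul hinv).const_smul (3 / 2 : ℝ)

end Smooth

/-! ## The equations as vanishing of the level-zero residual functions -/

section Level0

variable (hζ : ContDiff ℝ ∞ ζ) (hτ : 0 < τ)
  (h : IsPrimitiveEulerSolutionOn (EulerEOS.monatomicExcess ζ f) (Icc 0 τ) ρ u ϑ)
include h

/-- The continuity equation, as a function of `x`. [folklore] -/
theorem res₁_fun_eq_zero {s : ℝ} (hs : s ∈ Icc 0 τ) :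
    (fun y => timeDerivWithin (Icc 0 τ) ρ s y + (∑ i, u s y i * partialDeriv i (ρ s) y) +
      ρ s y * divergence (u s) y) = fun _ => 0 :=
  funext fun y => h.continuity s hs y

include hζ in
/-- The momentum equation in symmetric form, as a function of `x`. [folklore] -/
theorem res₂_fun_eq_zero {s : ℝ} (hs : s ∈ Icc 0 τ) :
    (fun y => timeDerivWithin (Icc 0 τ) u s y + (∑ i, u s y i • partialDeriv i (u s) y) +
      coefA ζ ρ ϑ s y • gradient (ρ s) y + coefB ζ ρ s y • gradient (ϑ s) y) = fun _ => 0 :=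
  funext fun y => by
    have e := h.euler_monatomicExcess hζ hs y
    simp only [coefA, coefB, mul_div_assoc] at e ⊢
    exact e

include hτ in
/-- The temperature equation, as a function of `x`. [folklore] -/
theorem res₃_fun_eq_zero {s : ℝ} (hs : s ∈ Icc 0 τ) :
    (fun y => timeDerivWithin (Icc 0 τ) ϑ s y + (∑ i, u s y i * partialDeriv i (ϑ s) y) +
      coefG ζ ρ ϑ s y * divergence (u s) y) = fun _ => 0 :=
  funext fun y => h.temperature_eq (uniqueDiffOn_Icc hτ) hs y

end Level0

end CompressibleEuler

end Literature.Analysis.FluidPDE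

end
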